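import Summits.Ventures.PercRepro.Night2LocalD3ZeroClosure

/-!
# PercRepro — the regime `|E ∖ G| = 3` at `q = 4`: many coloops force layer 0 (night-2, gen 12)

* `coloops_subset_of_not_lay0`: at `|E ∖ G| ≤ q` a member outside layer 0 contains every coloop of `M|G` (the
  coloops lie in its closure by `coloops_subset_clF_of_two_le`, and a coloop `y` outside `B ⊆ G ∖ y` would lie in
  `cl (G ∖ y)`);
* **`kColoops_add_one_le_of_not_lay0`**: hence `E ∖ B ⊆ (G ∖ K) ∪ (E ∖ G)` has rank `≤ (q + 1 − k) + d`, while a member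
  has `ρ(E ∖ B) = q + 2`: a member outside layer 0 forces `k + 1 ≤ d` — at `d = q` this is the known `k ≤ q − 1`, at
  `d = 3` it is `k ≤ 2`;
* `localShadowHall_d3_of_three_le_kColoops`: at `d = 3`, `q = 4`, with `≥ 3` coloops of `M|G` every member is
  layer-0 and the tree's `localShadowHall_of_all_lay0` closes the flat;
The reduction of the regime to `1 ≤ kColoops G ≤ 2` and the `(6, 4)` row statement are in `Night2LocalD3SixFour.lean`.
-/

open scoped Matroid

namespace PercRepro.Shadow

open Finset PerFlat ThmH

variable {α : Type*} [DecidableEq α] {M : Matroid α} [M.Finite]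

section Coloops

variable {q : ℕ} {G : Finset α}

open scoped Classical in
/-- At `|E ∖ G| ≤ q`, a member outside layer 0 contains every coloop of `M|G`. -/
theorem coloops_subset_of_not_lay0 (hG : G ∈ flatsQ M (q + 1)) (hd : (gr M \ G).card ≤ q) {B : Finset α}
    (hB : B ∈ membersIn M (Uq M (q + 2) q) G) (hB0 : B ∉ lay0 M q G) :
    (G.filter (fun y => y ∉ clF M (G.erase y))) ⊆ B := by
  have h2 := two_le_card_sdiff_of_not_lay0 hG hd hB hB0
  have hKcl := coloops_subset_clF_of_two_le hG hB h2
  have hBG : clF M B ⊆ G := (mem_membersIn.1 hB).2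
  have hBU : B ∈ Uq M (q + 2) q := (mem_membersIn.1 hB).1
  have hBcl : B ⊆ clF M B := subset_clF hBU
  intro y hy
  have hyK := hy
  rw [Finset.mem_filter] at hyK
  by_contra hyB
  have hsub : B ⊆ G.erase y := by
    intro x hx
    rw [Finset.mem_erase]
    refine ⟨?_, hBG (hBcl hx)⟩
    rintro rfl
    exact hyB hx
  have : y ∈ clF M (G.erase y) := clF_mono hsub (hKcl hy)
  exact hyK.2 this

open scoped Classical in
/-- **A member outside layer 0 forces `kColoops G + 1 ≤ |E ∖ G|`**: `E ∖ B ⊆ (G ∖ K) ∪ (E ∖ G)` has rank at most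
`(q + 1 − k) + d`, and a member has `ρ(E ∖ B) = q + 2`. -/
theorem kColoops_add_one_le_of_not_lay0 (hG : G ∈ flatsQ M (q + 1)) {d : ℕ} (hd : (gr M \ G).card = d)
    (hdq : d ≤ q) {B : Finset α} (hB : B ∈ membersIn M (Uq M (q + 2) q) G) (hB0 : B ∉ lay0 M q G) :
    kColoops M G + 1 ≤ d := by
  have hGg : G ⊆ gr M := (mem_flatsQ.1 hG).1
  have hGr : rkN M G = q + 1 := by
    have h := (mem_flatsQ.1 hG).2.2
    rw [eRk_eq_rkN] at h
    exact_mod_cast h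
  set K := G.filter (fun y => y ∉ clF M (G.erase y)) with hKdef
  have hKB : K ⊆ B := coloops_subset_of_not_lay0 hG (hd ▸ hdq) hB hB0
  have hBU : B ∈ Uq M (q + 2) q := (mem_membersIn.1 hB).1
  have hBG : B ⊆ G := (subset_clF hBU).trans (mem_membersIn.1 hB).2
  have hr : rkN M (gr M \ B) = q + 2 := by
    have h := (mem_Uq.1 hBU).2.2
    rw [eRk_eq_rkN] at h
    exact_mod_cast h
  -- `ρ(G ∖ K) + #K = ρ(G)`
  have hGK : rkN M (G \ K) + K.card = q + 1 := by
    have h := eRk_eq_kColoops_add (M := M) hGg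
    rw [← hKdef, eRk_eq_rkN, eRk_eq_rkN] at h
    have h' : rkN M G = K.card + rkN M (G \ K) := by exact_mod_cast h
    omega
  -- `E ∖ B ⊆ (G ∖ K) ∪ (E ∖ G)`
  have hsub : gr M \ B ⊆ (G \ K) ∪ (gr M \ G) := by
    intro x hx
    rw [Finset.mem_sdiff] at hx
    rw [Finset.mem_union, Finset.mem_sdiff, Finset.mem_sdiff]
    by_cases hxG : x ∈ G
    · left
      exact ⟨hxG, fun hxK => hx.2 (hKB hxK)⟩
    · right
      exact ⟨hx.1, hxG⟩
  have h1 : rkN M (gr M \ B) ≤ rkN M ((G \ K) ∪ (gr M \ G)) := rkN_mono hsub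
  have h2 := rkN_inter_add_rkN_union_le (M := M) (G \ K) (gr M \ G)
  have h3 : rkN M (gr M \ G) ≤ d := hd ▸ rkN_le_card _
  unfold kColoops
  rw [← hKdef]
  omega

end Coloops

section DThree

variable {G : Finset α}

open scoped Classical in
/-- At `d = 3`, `q = 4`, with at least three coloops of `M|G` every member is layer-0, so (LI_G) holds. -/
theorem localShadowHall_d3_of_three_le_kColoops (hG : G ∈ flatsQ M (4 + 1)) (hd : (gr M \ G).card = 3)
    (hk : 3 ≤ kColoops M G) : LocalShadowHall M 4 G := by
  apply localShadowHall_of_all_lay0 hG (by omega)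
  intro B hB
  by_contra hne
  have hB0 : B ∉ lay0 M 4 G := by
    intro h0
    exact hne (mem_lay0.1 h0).2.1
  have := kColoops_add_one_le_of_not_lay0 hG hd (by norm_num) hB hB0
  omega

end DThree

end PercRepro.Shadow
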